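import Summits.Ventures.Crystal3D.Theorems.StickyWulffConstantCoaxialWallLawTailResidueDefsL
import HarnessLib

/-!
# Soundness lemma (LR) for the certificate checker `capcc`: realisability ⇒ the witness constraints at a pool member
# (crux `CoaxialWallLaw`, stmt-Ventures-19481)

HONEST FRAMING. Venture `Summits/Ventures/Crystal3D` (cell `crystal3d-full`); helper `--supports` the crux `CoaxialWallLaw`
(stmt-Ventures-19481, `route-Ventures-StickyWulffConstant`), registered line 'CoaxialWallLawCertificates' (planner cf-p1, stub
`stub_lensCert`); sixth file of the checker-soundness series.  SOURCE: cf-p2's certificate schema v1, PREREG (69.0⁷) S-1 (witness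
semantics) and S-3 (LR): «in DefsL terms `τ.looseAt y ≤ k` for every Realisable `τ`; the reduction Realisable ⇒ the witness constraints is
lemma (LR), routine from `LensType.Realisable`».
THE REDUCTION.  For a position-based lens type `τ` (`…TailResidueDefsL`) with a JOINT witness system `ξ` (`LensType.Realisable`) and any
point `y`, the loose fillers hosted at `y` (those `H ∈ τ.loose` with `y ∈ H.image τ.hostPoint` — their number is `τ.looseAt y`) have
witnesses `ξ i` with `u_i := ξ i − y` satisfying: `‖u_i‖ = 1` (distance `1` from the host point `y`); `⟪u_i, p − y⟫ ≤ ‖p − y‖²/2` for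
every exact ball `p ∈ τ.realise`, `p ≠ y` (distance `≥ 1`: `= 1` for the other hosts, `> 1` otherwise); `y + u_i` off the module
`coaxialModule 1 √(2/3)` and at no apex position `fineVec F`, `F ∈ apexBall` (the forbidden directions); pairwise `‖u_i − u_j‖ ≥ 1`.
* `length_filter_le_card` — counting bridge: the `p`-entries of a list are at most `#T` if their indices map injectively into `T`.
* `inner_le_of_one_le_norm_sub` — `‖u‖ = 1`, `1 ≤ ‖u − w‖ ⇒ ⟪u, w⟫ ≤ ‖w‖²/2` (the blocker constraint).
* **`looseAt_le_of_witnessBound`** (LR) — if every finite family `T` of unit vectors with these four properties has `#T ≤ k`, then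
  `τ.looseAt y ≤ k`.  The hypothesis is exactly what the checker's cover/patch bookkeeping (`CapChecker.card_le_of_capCover`,
  `card_le_of_patches`) delivers for `V = E³`.
WHAT THIS IS NOT: not the checker; no use of `WellFormed`, of the module metric or of coordinates; F-C1 not moved.
-/

namespace Summit.Ventures.Crystal3D.Theorems

namespace CapChecker

open Finset TailResidue
open scoped InnerProductSpace

/-! ### Counting bridge -/

/-- **Counting bridge.**  If the indices `i` of the entries of `l` satisfying `p` are mapped by `g` into a finite set `T`, injectively,
then `(l.filter p).length ≤ #T`. -/
theorem length_filter_le_card {α β : Type*} [DecidableEq β] (l : List α) (p : α → Bool) (T : Finset β) (g : ℕ → β)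
    (hg : ∀ (i : ℕ) (a : α), l[i]? = some a → p a = true → g i ∈ T)
    (hinj : ∀ (i j : ℕ) (a b : α), l[i]? = some a → l[j]? = some b → p a = true → p b = true → g i = g j → i = j) :
    (l.filter p).length ≤ T.card := by
  induction l generalizing T g with
  | nil => simp
  | cons a l ih =>
    have hg' : ∀ (i : ℕ) (b : α), l[i]? = some b → p b = true → g (i + 1) ∈ T := fun i b hb hpb =>
      hg (i + 1) b (by simpa using hb) hpb
    have hinj' : ∀ (i j : ℕ) (b c : α), l[i]? = some b → l[j]? = some c → p b = true → p c = true →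
        g (i + 1) = g (j + 1) → i = j := fun i j b c hb hc hpb hpc heq => by
      have := hinj (i + 1) (j + 1) b c (by simpa using hb) (by simpa using hc) hpb hpc heq
      omega
    by_cases hpa : p a = true
    · rw [List.filter_cons_of_pos hpa, List.length_cons]
      have h0 : g 0 ∈ T := hg 0 a (by simp) hpa
      have hmem : ∀ (i : ℕ) (b : α), l[i]? = some b → p b = true → g (i + 1) ∈ T.erase (g 0) := by
        intro i b hb hpb
        refine Finset.mem_erase.2 ⟨fun heq => ?_, hg' i b hb hpb⟩
        have := hinj (i + 1) 0 b a (by simpa using hb) (by simp) hpb hpa heq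
        omega
      have h1 := ih (T.erase (g 0)) (fun i => g (i + 1)) hmem hinj'
      rw [Finset.card_erase_of_mem h0] at h1
      have h2 : 0 < T.card := Finset.card_pos.2 ⟨_, h0⟩
      omega
    · rw [List.filter_cons_of_neg hpa]
      exact ih T (fun i => g (i + 1)) hg' hinj'

/-! ### The blocker constraint from a distance bound -/

/-- `‖u‖ = 1` and `1 ≤ ‖u − w‖` give `⟪u, w⟫ ≤ ‖w‖²/2` (a witness at `y + u` and an exact ball at `y + w` are `≥ 1` apart iff the blocker
constraint holds). -/
theorem inner_le_of_one_le_norm_sub {u w : EuclideanSpace ℝ (Fin 3)} (hu : ‖u‖ = 1) (h : 1 ≤ ‖u - w‖) :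
    ⟪u, w⟫_ℝ ≤ ‖w‖ ^ 2 / 2 := by
  have h1 : 1 ≤ ‖u - w‖ ^ 2 := by nlinarith
  rw [norm_sub_sq_real, hu] at h1
  linarith

/-! ### (LR) -/

/-- **(LR) realisability ⇒ the witness constraints.**  `τ` a position-based lens type with a joint witness system (`τ.Realisable`), `y` any
point.  If every finite family `T ⊆ E³` of unit vectors such that (i) `⟪u, p − y⟫ ≤ ‖p − y‖²/2` for all `u ∈ T` and all exact balls
`p ∈ τ.realise`, `p ≠ y`; (ii) `y + u` is off the module and at no apex position of the window; (iii) `T` is pairwise at chord distance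
`≥ 1` — has at most `k` members, then at most `k` loose fillers are hosted at `y`: `τ.looseAt y ≤ k`. -/
theorem looseAt_le_of_witnessBound (τ : LensType) (hR : τ.Realisable) (y : EuclideanSpace ℝ (Fin 3)) {k : ℕ}
    (H : ∀ T : Finset (EuclideanSpace ℝ (Fin 3)), (∀ u ∈ T, ‖u‖ = 1) →
      (∀ u ∈ T, ∀ p ∈ τ.realise, p ≠ y → ⟪u, p - y⟫_ℝ ≤ ‖p - y‖ ^ 2 / 2) →
      (∀ u ∈ T, y + u ∉ coaxialModule 1 (Real.sqrt (2 / 3)) ∧ ∀ F ∈ apexBall, y + u ≠ fineVec F) →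
      ((↑T : Set (EuclideanSpace ℝ (Fin 3))).Pairwise fun u v => 1 ≤ ‖u - v‖) → T.card ≤ k) :
    τ.looseAt y ≤ k := by
  classical
  obtain ⟨-, ξ, hξ, hsep⟩ := hR
  -- hosted indices and their witnesses
  have hhost : ∀ (i : ℕ) (Hs : Finset HostRefL), τ.loose[i]? = some Hs → y ∈ Hs.image τ.hostPoint →
      i < τ.loose.length ∧ ‖ξ i - y‖ = 1 ∧
        (∀ p ∈ τ.realise, p ≠ y → ⟪ξ i - y, p - y⟫_ℝ ≤ ‖p - y‖ ^ 2 / 2) ∧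
        (y + (ξ i - y) ∉ coaxialModule 1 (Real.sqrt (2 / 3)) ∧ ∀ F ∈ apexBall, y + (ξ i - y) ≠ fineVec F) := by
    intro i Hs hi hy
    obtain ⟨hlt, -⟩ := List.getElem?_eq_some_iff.1 hi
    obtain ⟨hmod, hapex, hhosts, hfar⟩ := hξ i Hs hi
    obtain ⟨h, hh, rfl⟩ := Finset.mem_image.1 hy
    have hd : ‖ξ i - τ.hostPoint h‖ = 1 := by rw [← dist_eq_norm]; exact hhosts h hh
    refine ⟨hlt, hd, ?_, ?_⟩
    · intro p hp hpy
      have h1 : 1 ≤ ‖(ξ i - τ.hostPoint h) - (p - τ.hostPoint h)‖ := by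
        rw [sub_sub_sub_cancel_right, ← dist_eq_norm]
        by_cases hpH : p ∈ Hs.image τ.hostPoint
        · obtain ⟨h', hh', rfl⟩ := Finset.mem_image.1 hpH
          exact (hhosts h' hh').symm.le
        · exact (hfar p hp hpH).le
      exact inner_le_of_one_le_norm_sub hd h1
    · rw [add_sub_cancel]
      exact ⟨hmod, hapex⟩
  -- the family `T` (over an opaque copy `Q` of the «hosted at `y`» predicate, to fix one decidability instance)
  obtain ⟨Q, hQ⟩ : ∃ Q : ℕ → Prop, ∀ i, Q i ↔ ∃ Hs : Finset HostRefL, τ.loose[i]? = some Hs ∧ y ∈ Hs.image τ.hostPoint :=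
    ⟨_, fun i => Iff.rfl⟩
  set T : Finset (EuclideanSpace ℝ (Fin 3)) := ((Finset.range τ.loose.length).filter Q).image fun i => ξ i - y with hT
  have hTmem : ∀ u ∈ T, ∃ i, (∃ Hs : Finset HostRefL, τ.loose[i]? = some Hs ∧ y ∈ Hs.image τ.hostPoint) ∧ u = ξ i - y := by
    intro u hu
    rw [hT, Finset.mem_image] at hu
    obtain ⟨i, hi, rfl⟩ := hu
    exact ⟨i, (hQ i).1 (Finset.mem_filter.1 hi).2, rfl⟩
  have hTk : T.card ≤ k := by
    refine H T ?_ ?_ ?_ ?_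
    · intro u hu
      obtain ⟨i, ⟨Hs, hi, hy⟩, rfl⟩ := hTmem u hu
      exact (hhost i Hs hi hy).2.1
    · intro u hu
      obtain ⟨i, ⟨Hs, hi, hy⟩, rfl⟩ := hTmem u hu
      exact (hhost i Hs hi hy).2.2.1
    · intro u hu
      obtain ⟨i, ⟨Hs, hi, hy⟩, rfl⟩ := hTmem u hu
      exact (hhost i Hs hi hy).2.2.2
    · intro u hu v hv huv
      obtain ⟨i, ⟨Hs, hi, hy⟩, rfl⟩ := hTmem u hu
      obtain ⟨j, ⟨Hs', hj, hy'⟩, rfl⟩ := hTmem v hv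
      have hij : i ≠ j := fun h => huv (by rw [h])
      rw [sub_sub_sub_cancel_right, ← dist_eq_norm]
      exact hsep i j hij (hhost i Hs hi hy).1 (hhost j Hs' hj hy').1
  -- count
  refine le_trans ?_ hTk
  unfold LensType.looseAt
  refine length_filter_le_card τ.loose _ T (fun i => ξ i - y) ?_ ?_
  · intro i Hs hi hp
    rw [decide_eq_true_iff] at hp
    rw [hT, Finset.mem_image]
    exact ⟨i, Finset.mem_filter.2 ⟨Finset.mem_range.2 (hhost i Hs hi hp).1, (hQ i).2 ⟨Hs, hi, hp⟩⟩, rfl⟩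
  · intro i j Hs Hs' hi hj hp hp' heq
    rw [decide_eq_true_iff] at hp hp'
    by_contra hij
    have h1 := hsep i j hij (hhost i Hs hi hp).1 (hhost j Hs' hj hp').1
    have h2 : ξ i = ξ j := by
      have := congrArg (fun z => z + y) heq
      simpa using this
    rw [h2, dist_self] at h1
    linarith

end CapChecker

end Summit.Ventures.Crystal3D.Theorems
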